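import Summits.MatrixMultiplication.OmegaCensus.STPPBlockVolumeAlignedLaw

/-!
# ω-census (abelian STPP census): filter N17 — the KNESER-BOOSTED ALIGNED LAW (kernel)

HONEST FRAMING (pub-omega census; verbatim): lottery ticket; floor = certified bounds/negative ranges.
Census BOOKKEEPING / STRUCTURE (seat pub-omega-stpp-1 gen 27, 2026-08-27), family (b2).  A necessary condition on STPP families in finite
abelian groups — a tool for EXCLUDING candidate block patterns by theorem; nothing here is progress on `ω`.

## Statement

Let `(Aᵢ, Bᵢ, Cᵢ)_{i<N}` (`N ≥ 2`) be an STPP family (CKSU 2005 Def. 5.1, the tree's `IsSTPP`) with non-empty sets in a finite abelian group `H`,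
`|H| = n`; `X_k = B_k − A_k`, `Y_k = C_k − B_k`, `Z_k = C_k − A_k`; for a block `i` write `vol = aᵢbᵢcᵢ`, `Y° = ⋃_{k≠i} Y_k` (`|Y°| = Σ_{k≠i} b_k c_k`),
`Z° = ⋃_{k≠i} Z_k` (`|Z°| = Σ_{k≠i} a_k c_k`), `W = Cᵢ − Aᵢ − Bᵢ` (`|e + W| = vol`), and `kLB(s,t,d) = (⌈s/d⌉ + ⌈t/d⌉ − 1)·d` (`STPPKneser.kneserLB`).

N16 (`STPPBlockVolumeAlignedLaw.lean`) packs `(e_B + W) ⊔ (e_B − e_A + Y°) ⊔ Z° ⊆ H` for ONE pair `e_A ∈ Aᵢ`, `e_B ∈ Bᵢ`.  Taking the UNION over `e_A`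
(resp. over `e_B`) turns the middle (resp. the first two) pieces into a SUMSET, and Kneser's theorem bounds a sumset from below:

* (A-side, `translateA_add_DU_BC_subset`) `(e_B − Aᵢ) + Y° ⊆ H ∖ (Z° ⊔ (e_B + W))`, hence (`exists_dvd_alignedKneser_A`)
  `∃ d ∣ n : vol + |Z°| + kLB(aᵢ, |Y°|, d) ≤ n`;
* (B-side, `B_add_W_union_subset`) `Bᵢ + (W ⊔ (Y° − e_A)) ⊆ H ∖ Z°`, hence (`exists_dvd_alignedKneser_B`)
  `∃ d ∣ n : |Z°| + kLB(bᵢ, vol + |Y°|, d) ≤ n`.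

**Filter N17**: a pattern is dead if for some block and some of the SIX role readings (`stpp_rotate`, `isSTPP_neg_reverse`) one of the two sides fails
for EVERY divisor `d` of `n` (decidable predicate `N17Dead`, `not_isSTPP_of_n17Dead{1,,'}`; shape of `N8Dead`).  The divisor `d = 1` is N16 sharpened by
`aᵢ − 1` resp. `bᵢ − 1` (Cauchy–Davenport), so in `ℤ_p`: `vol + Σ_{k≠i}(a_k + b_k)c_k + max(aᵢ, bᵢ) − 1 ≤ p`; a divisor `d ≥ aᵢ` with `d ∣ |Y°|` gives back
N16 exactly — the periodic case (`Y°` a union of cosets of `⟨Aᵢ − Aᵢ⟩`), which is what N16-tightness forces.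

Measured bite (HOME `pub-omega-stpp-1-g27/fronts/`, numbers only; python reader `n17_filter.py`, six roles): ℤ₅₇ front of record (2 128): alive under
N7–N12 + N16 = 33 → with N17 **20**; ℤ₅₈ front (GO #52, 217 997 N8-leaves): 640 → **84**; ℤ₅₉ (46 477 N9-leaves): 850 → **124**; ℤ₅₇ cores 23/108; the 17
abelian logs (orders 48–57): UNSAT 1 642/5 588, cores 894/4 025; abelian `≤ 16` census: 47/201 INFEASIBLE items.  SOUNDNESS of the arithmetic: 0/568 FEASIBLE,
0/1 984 SAT-witnessed patterns; set-level re-check of both inclusions and both Kneser-form inequalities on 645 SAT witness families × 6 role maps × every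
`(i, e_A)` / `(i, e_B)`: 101 210 checks, 0 violations.

References: M. Kneser, Math. Z. 58 (1953) (tree: `Literature.Combinatorics.Additive.add_kneser`); H. Cohn, R. Kleinberg, B. Szegedy, C. Umans, FOCS 2005
(arXiv:math/0511460), Def. 5.1.
-/

open Finset
open scoped Pointwise

namespace Summit.MatrixMultiplication.OmegaCensus.CubeNB

open Literature.Computability.AlgebraicComplexity
open Summit.MatrixMultiplication.OmegaCensus.STPPKneser

variable {H : Type*} [AddCommGroup H] [DecidableEq H] [Fintype H] {N : ℕ} {A B C : Fin N → Finset H}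

/-! ## §1 The two sumset inclusions and their Kneser consequences -/

section Law

/-- **A-side inclusion.**  `(e_B − Aᵢ) + Y° ⊆ H ∖ (Z° ∪ (e_B + W))`: each translate `(e_B − a) + Y°` (`a ∈ Aᵢ`) misses `Z°` (alignment with `e_A := a`)
and misses the block sumset `e_B + W` (pattern `(i,k,i)`, `disjoint_image_blockSum_translate_DU_full`). [cite: CohnKleinbergSzegedyUmans2005, Def. 5.1] -/
theorem translateA_add_DU_BC_subset (hS : IsSTPP A B C) (i : Fin N) {eB : H} (heB : eB ∈ B i) :
    (A i).image (fun a => eB - a) + DU B C (univ.erase i) ⊆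
      univ \ (DU A C (univ.erase i) ∪
        ((A i) ×ˢ ((B i) ×ˢ (C i))).image fun q : H × H × H => eB + q.2.2 - q.1 - q.2.1) := by
  intro w hw
  rw [Finset.mem_sdiff]
  refine ⟨Finset.mem_univ _, fun hw' => ?_⟩
  obtain ⟨x, hx, y, hy, rfl⟩ := Finset.mem_add.1 hw
  obtain ⟨a, ha, rfl⟩ := Finset.mem_image.1 hx
  have hmem : eB - a + y ∈ (DU B C (univ.erase i)).image fun y => eB - a + y := Finset.mem_image.2 ⟨y, hy, rfl⟩
  rcases Finset.mem_union.1 hw' with hz | hF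
  · exact Finset.disjoint_left.1 (disjoint_translate_DU_BC_DU_AC hS i ha heB) hmem hz
  · exact Finset.disjoint_left.1 (disjoint_image_blockSum_translate_DU_full hS i (eB := eB) ha) hF hmem

/-- **N17, A-side.**  For an STPP family with non-empty `A`-, `B`-, `C`-sets, a block `i` and another block `j ≠ i`: for SOME divisor `d` of `|H|`,
`|Aᵢ||Bᵢ||Cᵢ| + Σ_{k≠i} |A_k||C_k| + kLB(|Aᵢ|, Σ_{k≠i} |B_k||C_k|, d) ≤ |H|` (Kneser on the A-side inclusion). [cite: Kneser1953]
[cite: CohnKleinbergSzegedyUmans2005, Def. 5.1] -/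
theorem exists_dvd_alignedKneser_A (hS : IsSTPP A B C) (hA : ∀ i, (A i).Nonempty) (hB : ∀ i, (B i).Nonempty)
    (hC : ∀ i, (C i).Nonempty) (i : Fin N) (hI : (univ.erase i : Finset (Fin N)).Nonempty) :
    ∃ d : ℕ, 0 < d ∧ d ∣ Fintype.card H ∧
      #(A i) * #(B i) * #(C i) + ∑ k ∈ univ.erase i, #(A k) * #(C k) +
        kneserLB #(A i) (∑ k ∈ univ.erase i, #(B k) * #(C k)) d ≤ Fintype.card H := by
  obtain ⟨eB, heB⟩ := hB i
  set S := (A i).image (fun a => eB - a) with hSdef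
  set T := DU B C (univ.erase i) with hT
  set Zo := DU A C (univ.erase i) with hZo
  set F := ((A i) ×ˢ ((B i) ×ˢ (C i))).image fun q : H × H × H => eB + q.2.2 - q.1 - q.2.1 with hF
  have hScard : #S = #(A i) := Finset.card_image_of_injective _ (sub_right_injective)
  have hTcard : #T = ∑ k ∈ univ.erase i, #(B k) * #(C k) := card_DU_BC hS hA _
  have hZcard : #Zo = ∑ k ∈ univ.erase i, #(A k) * #(C k) := card_DU_AC hS hB _
  have hFcard : #F = #(A i) * #(B i) * #(C i) := card_image_blockSum hS i eB
  have hZF : Disjoint Zo F := (disjoint_image_blockSum_DU hS i heB).symm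
  have hU : #(univ \ (Zo ∪ F)) = Fintype.card H - (#Zo + #F) := by
    rw [Finset.card_sdiff_of_subset (Finset.subset_univ _), Finset.card_univ, Finset.card_union_of_disjoint hZF]
  have hle : #Zo + #F ≤ Fintype.card H := by
    rw [← Finset.card_union_of_disjoint hZF]; exact Finset.card_le_univ _
  obtain ⟨d, hd, hdvd, hk⟩ := exists_dvd_kneserLB_le_card_add S T ((hA i).image _) (DU_nonempty hI hB hC)
  have hsub0 := Finset.card_le_card (translateA_add_DU_BC_subset hS i heB)
  rw [hU] at hsub0
  have hsub : #(S + T) ≤ Fintype.card H - (#Zo + #F) := hsub0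
  rw [hScard, hTcard] at hk
  rw [hZcard, hFcard] at hsub hle
  exact ⟨d, hd, hdvd, by omega⟩

omit [Fintype H] in
/-- **B-side inclusion.**  `Bᵢ + (W ∪ (Y° − e_A)) ⊆ H ∖ Z°` (`W = Cᵢ − Aᵢ − Bᵢ`): `b + w ∈ b + W` misses `Z°` (pattern `(i,i,k)`, N14) and `b + (y − e_A) = (b − e_A) + y`
misses `Z°` (alignment). [cite: CohnKleinbergSzegedyUmans2005, Def. 5.1] -/
theorem B_add_W_union_subset [Fintype H] (hS : IsSTPP A B C) (i : Fin N) {eA : H} (heA : eA ∈ A i) :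
    B i + ((((A i) ×ˢ ((B i) ×ˢ (C i))).image fun q : H × H × H => (0 : H) + q.2.2 - q.1 - q.2.1) ∪
        (DU B C (univ.erase i)).image fun y => (0 : H) - eA + y) ⊆ univ \ DU A C (univ.erase i) := by
  intro w hw
  rw [Finset.mem_sdiff]
  refine ⟨Finset.mem_univ _, fun hz => ?_⟩
  obtain ⟨b, hb, v, hv, rfl⟩ := Finset.mem_add.1 hw
  rcases Finset.mem_union.1 hv with hvW | hvY
  · obtain ⟨⟨a, b', c⟩, hq, rfl⟩ := Finset.mem_image.1 hvW
    have hmem : b + ((0 : H) + c - a - b') ∈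
        ((A i) ×ˢ ((B i) ×ˢ (C i))).image fun q : H × H × H => b + q.2.2 - q.1 - q.2.1 := by
      refine Finset.mem_image.2 ⟨⟨a, b', c⟩, hq, ?_⟩
      show b + c - a - b' = b + ((0 : H) + c - a - b')
      abel
    exact Finset.disjoint_left.1 (disjoint_image_blockSum_DU hS i hb) hmem hz
  · obtain ⟨y, hy, rfl⟩ := Finset.mem_image.1 hvY
    have hmem : b + ((0 : H) - eA + y) ∈ (DU B C (univ.erase i)).image fun y => b - eA + y := by
      refine Finset.mem_image.2 ⟨y, hy, ?_⟩
      show b - eA + y = b + ((0 : H) - eA + y)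
      abel
    exact Finset.disjoint_left.1 (disjoint_translate_DU_BC_DU_AC hS i heA hb) hmem hz

/-- **N17, B-side.**  For an STPP family with non-empty sets, a block `i` and another block `j ≠ i`: for SOME divisor `d` of `|H|`,
`Σ_{k≠i} |A_k||C_k| + kLB(|Bᵢ|, |Aᵢ||Bᵢ||Cᵢ| + Σ_{k≠i} |B_k||C_k|, d) ≤ |H|` (Kneser on the B-side inclusion; `W` and `Y° − e_A` are disjoint by pattern `(i,k,i)`).
[cite: Kneser1953] [cite: CohnKleinbergSzegedyUmans2005, Def. 5.1] -/
theorem exists_dvd_alignedKneser_B (hS : IsSTPP A B C) (hA : ∀ i, (A i).Nonempty) (hB : ∀ i, (B i).Nonempty)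
    (hC : ∀ i, (C i).Nonempty) (i : Fin N) (hI : (univ.erase i : Finset (Fin N)).Nonempty) :
    ∃ d : ℕ, 0 < d ∧ d ∣ Fintype.card H ∧
      ∑ k ∈ univ.erase i, #(A k) * #(C k) +
        kneserLB #(B i) (#(A i) * #(B i) * #(C i) + ∑ k ∈ univ.erase i, #(B k) * #(C k)) d ≤ Fintype.card H := by
  obtain ⟨eA, heA⟩ := hA i
  set W := ((A i) ×ˢ ((B i) ×ˢ (C i))).image fun q : H × H × H => (0 : H) + q.2.2 - q.1 - q.2.1 with hW
  set Yt := (DU B C (univ.erase i)).image fun y => (0 : H) - eA + y with hYt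
  set Zo := DU A C (univ.erase i) with hZo
  have hWcard : #W = #(A i) * #(B i) * #(C i) := card_image_blockSum hS i 0
  have hYcard : #Yt = ∑ k ∈ univ.erase i, #(B k) * #(C k) := by
    rw [hYt, Finset.card_image_of_injective _ (add_right_injective ((0 : H) - eA)), card_DU_BC hS hA]
  have hZcard : #Zo = ∑ k ∈ univ.erase i, #(A k) * #(C k) := card_DU_AC hS hB _
  have hWY : Disjoint W Yt := disjoint_image_blockSum_translate_DU_full hS i (eB := 0) heA
  have hVcard : #(W ∪ Yt) = #(A i) * #(B i) * #(C i) + ∑ k ∈ univ.erase i, #(B k) * #(C k) := by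
    rw [Finset.card_union_of_disjoint hWY, hWcard, hYcard]
  have hU : #(univ \ Zo) = Fintype.card H - #Zo := by
    rw [Finset.card_sdiff_of_subset (Finset.subset_univ _), Finset.card_univ]
  have hle : #Zo ≤ Fintype.card H := Finset.card_le_univ _
  have hVne : (W ∪ Yt).Nonempty := by
    obtain ⟨y, hy⟩ := DU_nonempty hI hB hC
    exact ⟨(0 : H) - eA + y, Finset.mem_union_right _ (Finset.mem_image.2 ⟨y, hy, rfl⟩)⟩
  obtain ⟨d, hd, hdvd, hk⟩ := exists_dvd_kneserLB_le_card_add (B i) (W ∪ Yt) (hB i) hVne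
  have hsub0 := Finset.card_le_card (B_add_W_union_subset hS i heA)
  rw [hU] at hsub0
  have hsub : #(B i + (W ∪ Yt)) ≤ Fintype.card H - #Zo := hsub0
  rw [hVcard] at hk
  rw [hZcard] at hsub hle
  exact ⟨d, hd, hdvd, by omega⟩

end Law

/-! ## §2 The decidable card-vector predicate (six readings) and the filter theorem -/

section Filter

/-- **Filter N17, one reading** on the card vectors `(a, b, c)` of a pattern in a group of order `n`: some block `i` (with another block `j ≠ i`) violates the
A-side or the B-side Kneser inequality for EVERY candidate period `d ∣ n` (bounded quantifier, decidable).  Same verdicts as HOME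
`pub-omega-stpp-1-g27/fronts/n17_filter.py` (`dead_C`). [folklore] -/
def N17Dead1 (n N : ℕ) (a b c : Fin N → ℕ) : Bool :=
  decide (∃ i j : Fin N, j ≠ i ∧
    ((∀ d : ℕ, d < n + 1 → d ∣ n → 0 < d →
        n - (∑ k ∈ univ.erase i, a k * c k + a i * b i * c i) < kneserLB (a i) (∑ k ∈ univ.erase i, b k * c k) d) ∨
     (∀ d : ℕ, d < n + 1 → d ∣ n → 0 < d →
        n - ∑ k ∈ univ.erase i, a k * c k < kneserLB (b i) (a i * b i * c i + ∑ k ∈ univ.erase i, b k * c k) d)))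

/-- **Filter N17** on the card vectors: `N17Dead1` for one of the SIX role permutations `(a,b,c)`, `(b,c,a)`, `(c,a,b)`, `(c,b,a)`, `(b,a,c)`, `(a,c,b)`
(the A-side/B-side split is not invariant under the reflection). [folklore] -/
def N17Dead (n N : ℕ) (a b c : Fin N → ℕ) : Bool :=
  N17Dead1 n N a b c || N17Dead1 n N b c a || N17Dead1 n N c a b ||
    N17Dead1 n N c b a || N17Dead1 n N b a c || N17Dead1 n N a c b

/-- **Filter N17, one reading (kernel).**  An STPP family with non-empty sets whose card vectors satisfy `N17Dead1 |H|` does not exist.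
[cite: Kneser1953] [cite: CohnKleinbergSzegedyUmans2005, Def. 5.1] -/
theorem not_isSTPP_of_n17Dead1 (hS : IsSTPP A B C) (hA : ∀ i, (A i).Nonempty) (hB : ∀ i, (B i).Nonempty)
    (hC : ∀ i, (C i).Nonempty) {n : ℕ} (hn : Fintype.card H = n) {a b c : Fin N → ℕ} (ha : ∀ i, #(A i) = a i)
    (hb : ∀ i, #(B i) = b i) (hc : ∀ i, #(C i) = c i) (hdead : N17Dead1 n N a b c = true) : False := by
  obtain ⟨i, j, hji, h⟩ := of_decide_eq_true hdead
  have hI : (univ.erase i : Finset (Fin N)).Nonempty := ⟨j, Finset.mem_erase.2 ⟨hji, Finset.mem_univ _⟩⟩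
  have conv : ∀ {s t u : ℕ}, (∀ d : ℕ, d < n + 1 → d ∣ n → 0 < d → u < kneserLB s t d) →
      ∀ d : ℕ, 0 < d → d ∣ Fintype.card H → u < kneserLB s t d := by
    intro s t u hall d hd hdvd
    rw [hn] at hdvd
    have hn0 : n ≠ 0 := by rw [← hn]; exact Fintype.card_ne_zero
    exact hall d (Nat.lt_succ_of_le (Nat.le_of_dvd (Nat.pos_of_ne_zero hn0) hdvd)) hdvd hd
  have eAC : ∑ k ∈ univ.erase i, #(A k) * #(C k) = ∑ k ∈ univ.erase i, a k * c k :=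
    Finset.sum_congr rfl fun k _ => by rw [ha, hc]
  have eBC : ∑ k ∈ univ.erase i, #(B k) * #(C k) = ∑ k ∈ univ.erase i, b k * c k :=
    Finset.sum_congr rfl fun k _ => by rw [hb, hc]
  rcases h with h | h
  · obtain ⟨d, hd, hdvd, hle⟩ := exists_dvd_alignedKneser_A hS hA hB hC i hI
    rw [hn, ha, hb, hc, eAC, eBC] at hle
    have := conv h d hd hdvd
    omega
  · obtain ⟨d, hd, hdvd, hle⟩ := exists_dvd_alignedKneser_B hS hA hB hC i hI
    rw [hn, ha, hb, hc, eAC, eBC] at hle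
    have := conv h d hd hdvd
    omega

/-- **Filter N17 (kernel): an STPP family with non-empty sets in a finite abelian group `H` whose pattern `(|Aᵢ|,|Bᵢ|,|Cᵢ|)ᵢ` is `N17Dead |H|` does not
exist** — six readings via `stpp_rotate` and `isSTPP_neg_reverse`. [cite: Kneser1953] [cite: CohnKleinbergSzegedyUmans2005, Def. 5.1] -/
theorem not_isSTPP_of_n17Dead (hS : IsSTPP A B C) (hA : ∀ i, (A i).Nonempty) (hB : ∀ i, (B i).Nonempty)
    (hC : ∀ i, (C i).Nonempty) {n : ℕ} (hn : Fintype.card H = n) {a b c : Fin N → ℕ} (ha : ∀ i, #(A i) = a i)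
    (hb : ∀ i, #(B i) = b i) (hc : ∀ i, #(C i) = c i) (hdead : N17Dead n N a b c = true) : False := by
  simp only [N17Dead, Bool.or_eq_true] at hdead
  have hR := isSTPP_neg_reverse hS
  have hnA : ∀ i, #((fun j => -(A j)) i) = a i := fun i => by rw [card_neg_family, ha]
  have hnB : ∀ i, #((fun j => -(B j)) i) = b i := fun i => by rw [card_neg_family, hb]
  have hnC : ∀ i, #((fun j => -(C j)) i) = c i := fun i => by rw [card_neg_family, hc]
  rcases hdead with ((((h | h) | h) | h) | h) | h
  · exact not_isSTPP_of_n17Dead1 hS hA hB hC hn ha hb hc h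
  · exact not_isSTPP_of_n17Dead1 (stpp_rotate hS) hB hC hA hn hb hc ha h
  · exact not_isSTPP_of_n17Dead1 (stpp_rotate (stpp_rotate hS)) hC hA hB hn hc ha hb h
  · exact not_isSTPP_of_n17Dead1 hR (nonempty_neg_family hC) (nonempty_neg_family hB) (nonempty_neg_family hA)
      hn hnC hnB hnA h
  · exact not_isSTPP_of_n17Dead1 (stpp_rotate hR) (nonempty_neg_family hB) (nonempty_neg_family hA)
      (nonempty_neg_family hC) hn hnB hnA hnC h
  · exact not_isSTPP_of_n17Dead1 (stpp_rotate (stpp_rotate hR)) (nonempty_neg_family hA) (nonempty_neg_family hC)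
      (nonempty_neg_family hB) hn hnA hnC hnB h

/-- Card-vector form with literal vectors: non-emptiness from positivity of the entries. [cite: Kneser1953] [cite: CohnKleinbergSzegedyUmans2005, Def. 5.1] -/
theorem not_isSTPP_of_n17Dead' (hS : IsSTPP A B C) {n : ℕ} (hn : Fintype.card H = n) (a b c : Fin N → ℕ)
    (ha : ∀ i, #(A i) = a i) (hb : ∀ i, #(B i) = b i) (hc : ∀ i, #(C i) = c i)
    (hpos : ∀ i, 0 < a i ∧ 0 < b i ∧ 0 < c i) (hdead : N17Dead n N a b c = true) : False :=
  not_isSTPP_of_n17Dead hS (fun i => card_pos.1 ((ha i).symm ▸ (hpos i).1))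
    (fun i => card_pos.1 ((hb i).symm ▸ (hpos i).2.1)) (fun i => card_pos.1 ((hc i).symm ▸ (hpos i).2.2))
    hn ha hb hc hdead

end Filter

/-! ## §3 Examples -/

section Examples

/-- A ℤ₅₇ front leaf alive under N7–N12 and N16, `{(2,2,4), (2,3,3), (2,6,2)}` (`Σ abc = 58 > 57`; N16 value at the `(2,6,2)` block `24 + 14 + 17 = 55`), carries no
STPP family in ANY abelian group of order `57`: B-side at that block, `|Z°| + kLB(bᵢ, vol + |Y°|, d) = 14 + kLB(6, 41, d) = 60, 59, 71, 71 > 57` for `d = 1, 3, 19, 57`.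
[cite: Kneser1953] [cite: CohnKleinbergSzegedyUmans2005, Def. 5.1] -/
theorem no_isSTPP_Z57_224_233_262 (hH : Fintype.card H = 57) (A B C : Fin 3 → Finset H) (hS : IsSTPP A B C)
    (hA : ∀ i, #(A i) = ![2, 2, 2] i) (hB : ∀ i, #(B i) = ![2, 3, 6] i) (hC : ∀ i, #(C i) = ![4, 3, 2] i) : False :=
  not_isSTPP_of_n17Dead' hS hH _ _ _ hA hB hC (by decide) (by decide)

/-- In a group of PRIME order the divisor `d = 1` is N16 sharpened by `aᵢ − 1` (Cauchy–Davenport).  The ℤ₅₉ front leaf `{(2,3,3), (7,2,3)}` (`Σ abc = 60 > 59`;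
N16 value at the `(7,2,3)` block `42 + 6 + 9 = 57 ≤ 59`) carries no STPP family in any abelian group of order `59`: A-side, `42 + 6 + kLB(7, 9, 1) = 63 > 59` and
`kLB(7, 9, 59) = 59`. [cite: Kneser1953] [cite: CohnKleinbergSzegedyUmans2005, Def. 5.1] -/
theorem no_isSTPP_Z59_233_723 (hH : Fintype.card H = 59) (A B C : Fin 2 → Finset H) (hS : IsSTPP A B C)
    (hA : ∀ i, #(A i) = ![2, 7] i) (hB : ∀ i, #(B i) = ![3, 2] i) (hC : ∀ i, #(C i) = ![3, 3] i) : False :=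
  not_isSTPP_of_n17Dead' hS hH _ _ _ hA hB hC (by decide) (by decide)

end Examples

end Summit.MatrixMultiplication.OmegaCensus.CubeNB
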